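import Summits.ResolutionOfSingularities.ResolutionOfSingularities.Theorems.ConeExit.Negative.Mirror
import Literature.AlgebraicGeometry.Resolution.PlaneGermBlowupCalculus
import HarnessLib

/-!
# `WildCones.ConeExit` (stmt-ResolutionOfSingularities-16883), line `critical-plane`: stub `stub_planeCriterion`

THE PLANE CRITERION FOR NON-ISOLATEDNESS (any `p`, `n`, `κ`). Let `R = κ⟦u₁, …, uₙ⟧`,
`jac p c' = (∂₁ a, …, ∂ₙ a) ⊆ R` the Jacobian ideal of the cleaned state `a = ser p c'`, and let
`φ = MvPowerSeries.subst a` be the substitution of `R` along the formal 2-plane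
`u_m ↦ ĉ_m · X₀ + ℓ_m · X₁` into `S = K⟦X₀, X₁⟧` (`K` a field extension of `κ`). If the two
linear forms `λ = φ(u_j)`, `μ = φ(u_{j'})` are independent (`ĉ_j ℓ_{j'} - ĉ_{j'} ℓ_j ≠ 0`), if
`φ(∂_k a) = 0` for `k ≠ i` and if `g = φ(∂_i a)` is not a unit, then `R ⧸ jac` is NOT a finite
`κ`-module (the state is not isolated). This is the last step of `caseA_of` / `coneForcing_of` in
the line's skeleton.

Proof.
1. If `R ⧸ J` is module-finite over `κ` it is an Artinian ring, so a power of the maximal ideal of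
   the local ring `R` lies in `J` (`IsLocalRing.exists_maximalIdeal_pow_le_of_isArtinianRing_quotient`);
   in particular `u_m ^ N ∈ J` for all `m` (`planeCrit_exists_X_pow_mem`).
2. `φ` is a ring map killing all generators of `jac` but `∂_i a ↦ g`, so `φ(jac) ⊆ (g)` and
   `λ ^ N, μ ^ N ∈ (g)`.
3. Undoing the two independent linear forms, `X₀, X₁ ∈ √(g)`, i.e. `g ∣ X₀ ^ M` and `g ∣ X₁ ^ M'`.
4. `X₀`, `X₁` are non-associated primes of `K⟦X₀, X₁⟧`
   (`Literature.AlgebraicGeometry.Resolution.PlaneGerm.prime_X`), so such a `g` is a unit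
   (`planeCrit_isUnit_of_dvd_X_pow`) — contradicting `constantCoeff g = 0`.

Sources: the finiteness criterion for the Tjurina/Milnor algebra is folklore (e.g. Greuel–Lossen–
Shustin; Boubakri–Greuel–Markwig, §2 in positive characteristic). [cite: BoubakriGreuelMarkwig2010, §2]
-/

noncomputable section

-- single-problem summit: the doubled namespace component `ResolutionOfSingularities` is forced
set_option linter.dupNamespace false

open Summit.ResolutionOfSingularities.ResolutionOfSingularities.Theorems.ConeExit.Negative
  (clean bl ord dv tr step ser pd jac cone Linv dL)
open scoped BigOperators

namespace Summit.ResolutionOfSingularities.ResolutionOfSingularities.Theorems.WildConesConeExit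

/-- POWERS OF THE VARIABLES: if `κ⟦X₁, …, Xₙ⟧ ⧸ J` is a finite `κ`-module then some power of every
variable lies in `J` (the quotient is Artinian, so a power of the maximal ideal of the local ring
`κ⟦X⟧` lies in `J`). Converse of `module_finite_quotient_of_X_pow_mem`. [folklore] -/
theorem planeCrit_exists_X_pow_mem {n : ℕ} {κ : Type} [Field κ]
    (J : Ideal (MvPowerSeries (Fin n) κ)) (hfin : Module.Finite κ (MvPowerSeries (Fin n) κ ⧸ J)) :
    ∃ N : ℕ, ∀ m : Fin n, (MvPowerSeries.X m : MvPowerSeries (Fin n) κ) ^ N ∈ J := by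
  haveI : IsArtinianRing (MvPowerSeries (Fin n) κ ⧸ J) :=
    IsArtinianRing.of_finite κ (MvPowerSeries (Fin n) κ ⧸ J)
  obtain ⟨N, hN⟩ := IsLocalRing.exists_maximalIdeal_pow_le_of_isArtinianRing_quotient J
  refine ⟨N, fun m => hN (Ideal.pow_mem_pow ?_ N)⟩
  rw [IsLocalRing.mem_maximalIdeal, mem_nonunits_iff, MvPowerSeries.isUnit_iff_constantCoeff,
    MvPowerSeries.constantCoeff_X]
  exact not_isUnit_zero

/-- Distinct variables of `K⟦X₀, X₁⟧` do not divide each other. [folklore] -/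
theorem planeCrit_not_X_dvd_X {K : Type} [Field K] {s t : Fin 2} (hst : s ≠ t) :
    ¬ (MvPowerSeries.X s : MvPowerSeries (Fin 2) K) ∣ MvPowerSeries.X t := by
  rw [MvPowerSeries.X_dvd_iff]
  intro h
  have h1 := h (Finsupp.single t 1) (by rw [Finsupp.single_apply, if_neg (Ne.symm hst)])
  rw [MvPowerSeries.coeff_index_single_self_X] at h1
  exact one_ne_zero h1

/-- THE TWO-VARIABLE FACT: in `K⟦X₀, X₁⟧` a common divisor of a power of `X₀` and a power of `X₁`
is a unit (`X₀` is prime and does not divide `X₁`). [folklore] -/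
theorem planeCrit_isUnit_of_dvd_X_pow {K : Type} [Field K] {g : MvPowerSeries (Fin 2) K}
    {M M' : ℕ} (h0 : g ∣ MvPowerSeries.X 0 ^ M) (h1 : g ∣ MvPowerSeries.X 1 ^ M') : IsUnit g := by
  obtain ⟨h, hh⟩ := h0
  obtain ⟨i, j, b, c, -, hbc, hg, -⟩ :=
    mul_eq_mul_prime_pow (Literature.AlgebraicGeometry.Resolution.PlaneGerm.prime_X 0)
      (show g * h = 1 * MvPowerSeries.X 0 ^ M by rw [one_mul, hh])
  rcases Nat.eq_zero_or_pos i with hi | hi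
  · rw [hg, hi, pow_zero, mul_one]
    exact IsUnit.of_mul_eq_one c hbc.symm
  · exfalso
    have hX0g : (MvPowerSeries.X 0 : MvPowerSeries (Fin 2) K) ∣ g := by
      rw [hg]
      exact (dvd_pow_self _ hi.ne').mul_left b
    exact planeCrit_not_X_dvd_X (K := K) (by decide : (0 : Fin 2) ≠ 1)
      ((Literature.AlgebraicGeometry.Resolution.PlaneGerm.prime_X 0).dvd_of_dvd_pow
        (hX0g.trans h1))

/-- **PLANE CRITERION FOR NON-ISOLATEDNESS** (any `p`, `n`, `κ`): if the Jacobian ideal of a state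
dies, modulo one non-unit `g`, on a non-degenerate formal 2-plane, then the state is not isolated
(`κ⟦u⟧ ⧸ jac` is not a finite `κ`-module). [cite: BoubakriGreuelMarkwig2010, §2] -/
theorem stub_planeCriterion : ∀ (p n : ℕ) (κ : Type) [Field κ] (c' : (Fin n → ℕ) → κ) (i : Fin n) (K : Type) [Field K] [Algebra κ K] (ĉ ℓ : Fin n → K) (j j' : Fin n), ĉ j * ℓ j' - ĉ j' * ℓ j ≠ 0 → (∀ k : Fin n, k ≠ i → MvPowerSeries.subst (fun m : Fin n => MvPowerSeries.C (ĉ m) * MvPowerSeries.X (0 : Fin 2) + MvPowerSeries.C (ℓ m) * MvPowerSeries.X 1) (pd k (ser p c')) = 0) → MvPowerSeries.constantCoeff (MvPowerSeries.subst (fun m : Fin n => MvPowerSeries.C (ĉ m) * MvPowerSeries.X (0 : Fin 2) + MvPowerSeries.C (ℓ m) * MvPowerSeries.X 1) (pd i (ser p c'))) = 0 → ¬ Module.Finite κ (MvPowerSeries (Fin n) κ ⧸ jac p c') := by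
  intro p n κ _ c' i K _ _ ĉ ℓ j j' hd hk hi hfin
  set a : Fin n → MvPowerSeries (Fin 2) K := fun m : Fin n =>
    MvPowerSeries.C (ĉ m) * MvPowerSeries.X (0 : Fin 2) + MvPowerSeries.C (ℓ m) * MvPowerSeries.X 1
  have ha0 : ∀ m, MvPowerSeries.constantCoeff (a m) = 0 := by
    intro m
    simp only [a, map_add, map_mul, MvPowerSeries.constantCoeff_C, MvPowerSeries.constantCoeff_X,
      mul_zero, add_zero]
  have ha : MvPowerSeries.HasSubst a := MvPowerSeries.hasSubst_of_constantCoeff_zero ha0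
  -- (1) powers of the variables lie in the Jacobian ideal
  obtain ⟨N, hN⟩ := planeCrit_exists_X_pow_mem (jac p c') hfin
  -- (2) transport along the substitution algebra hom `φ`
  have hmap : Ideal.map (MvPowerSeries.substAlgHom ha) (jac p c') ≤
      Ideal.span {MvPowerSeries.subst a (pd i (ser p c'))} := by
    show Ideal.map (MvPowerSeries.substAlgHom ha) (Ideal.span (Set.range fun k => pd k (ser p c'))) ≤ _
    rw [Ideal.map_span, Ideal.span_le]
    rintro _ ⟨_, ⟨k, rfl⟩, rfl⟩
    rw [SetLike.mem_coe, MvPowerSeries.substAlgHom_apply]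
    by_cases hki : k = i
    · subst hki
      exact Ideal.mem_span_singleton_self _
    · rw [hk k hki]
      exact Ideal.zero_mem _
  have hpow : ∀ m : Fin n, (a m) ^ N ∈ Ideal.span {MvPowerSeries.subst a (pd i (ser p c'))} := by
    intro m
    have h1 := Ideal.mem_map_of_mem (MvPowerSeries.substAlgHom ha) (hN m)
    rw [map_pow, MvPowerSeries.substAlgHom_apply, MvPowerSeries.subst_X ha] at h1
    exact hmap h1
  -- (3) undo the two independent linear forms: `X₀, X₁ ∈ √(g)`
  set I : Ideal (MvPowerSeries (Fin 2) K) := Ideal.span {MvPowerSeries.subst a (pd i (ser p c'))}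
  have hlam : a j ∈ I.radical := ⟨N, hpow j⟩
  have hmu : a j' ∈ I.radical := ⟨N, hpow j'⟩
  have hX0 : MvPowerSeries.C (ĉ j * ℓ j' - ĉ j' * ℓ j) * (MvPowerSeries.X 0 : MvPowerSeries (Fin 2) K) =
      MvPowerSeries.C (ℓ j') * a j - MvPowerSeries.C (ℓ j) * a j' := by
    simp only [a, map_sub, map_mul]
    ring
  have hX1 : MvPowerSeries.C (ĉ j * ℓ j' - ĉ j' * ℓ j) * (MvPowerSeries.X 1 : MvPowerSeries (Fin 2) K) =
      MvPowerSeries.C (ĉ j) * a j' - MvPowerSeries.C (ĉ j') * a j := by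
    simp only [a, map_sub, map_mul]
    ring
  have hunC : ∀ f : MvPowerSeries (Fin 2) K,
      MvPowerSeries.C (ĉ j * ℓ j' - ĉ j' * ℓ j) * f ∈ I.radical → f ∈ I.radical := by
    intro f hf
    have : f = MvPowerSeries.C (ĉ j * ℓ j' - ĉ j' * ℓ j)⁻¹ *
        (MvPowerSeries.C (ĉ j * ℓ j' - ĉ j' * ℓ j) * f) := by
      rw [← mul_assoc, ← map_mul, inv_mul_cancel₀ hd, map_one, one_mul]
    rw [this]
    exact Ideal.mul_mem_left _ _ hf
  have hrad0 : (MvPowerSeries.X 0 : MvPowerSeries (Fin 2) K) ∈ I.radical := by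
    refine hunC _ ?_
    rw [hX0]
    exact sub_mem (Ideal.mul_mem_left _ _ hlam) (Ideal.mul_mem_left _ _ hmu)
  have hrad1 : (MvPowerSeries.X 1 : MvPowerSeries (Fin 2) K) ∈ I.radical := by
    refine hunC _ ?_
    rw [hX1]
    exact sub_mem (Ideal.mul_mem_left _ _ hmu) (Ideal.mul_mem_left _ _ hlam)
  obtain ⟨M, hM⟩ := hrad0
  obtain ⟨M', hM'⟩ := hrad1
  -- (4) the two-variable fact: `g` is a unit, contradicting `constantCoeff g = 0`
  have hunit : IsUnit (MvPowerSeries.subst a (pd i (ser p c'))) :=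
    planeCrit_isUnit_of_dvd_X_pow (Ideal.mem_span_singleton.mp hM) (Ideal.mem_span_singleton.mp hM')
  rw [MvPowerSeries.isUnit_iff_constantCoeff, hi] at hunit
  exact not_isUnit_zero hunit

end Summit.ResolutionOfSingularities.ResolutionOfSingularities.Theorems.WildConesConeExit

end
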